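import Summits.QuantumFields.BalabanUV.Beta.FP.KernelPeriodisationFibLoc
import Summits.QuantumFields.BalabanUV.Beta.FP.CompositeBorderTablesLetters

/-!
# `BalabanUV.Beta.FP.PeriodisedBorderTables` — road «FP» for binder row D1, ROUTE T (RULING R-FP-51, CONFIRMED; R-FP-52), row **(T-ID)**, THE
# BORDER-TABLE ∕ INSERTION HALF: the torus insertions `perF M (dper M (V κ u))` of a BLOCK-COVARIANT table family are the period sums over the
# TRANSLATED COPIES OF THE INSERTION BOND; for PACKER-SHAPED (border) tables `packK N T` they have NO ff ∕ mm block, their fm ∕ mf blocks are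
# SUPPORTED ON THE COARSE SUBLATTICE of the torus and are there the displayed double period sums of the unpacked tensor; they are symmetric,
# depend on the bond only through the torus bond, and finite bond-weighted sums (the background jets along a test field) periodise termwise

HONEST DEPENDENCY (page 1, mandatory): continuum YM on T⁴ ⇐ BetaPertH ∧ nine spine estimates (0/9 proved); BetaPertH ⇐ (D1) ∧ (D4) ∧ CAP+tail;
G-an2-4 gates asym, D1 and NE2/3/4.  HONEST FRAMING (cell contract, verbatim): «discharging `BetaPertH` makes Bałaban's UV stability UNCONDITIONAL —
a real constructive-QFT result; it is NOT the continuum limit and NOT the Clay problem.»  ABSOLUTE RULE (cell charter, verbatim): «No internally-minted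
statement may enter as a cited fact. Every hypothesis is either kernel-proved in this package or a verbatim quotation of a PUBLISHED theorem with page
reference. The manuscript(s) under audit are NOT citable for their own disputed steps — they are the thing under adjudication; programme-internal
(2001/route/tribunal) claims are never citable.»  THIS MODULE is [folklore] re-indexing of absolutely convergent (or termwise-vanishing) period sums over OUR
typed objects (gan24-p3's `perZ`∕`perF`∕`dper`, leaf-02's `packK`); no `def`, no `def … : Prop`, nothing cited, 0 sorry; 0 estimates; 0∕4 row-D1 binders;
NOT (T-ID) itself (the torus INSTANCE's identification of its twelve matrices is the owner's `FP/NestedStepLawTorusInstance` ∕ leaf-06's dictionary),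
NOT (T-INV), NOT SDF, NOT D1, NOT BetaPertH, NOT continuum, NOT Clay.  «not in print; our bookkeeping».

WHY (owner d1-p3 g17 [D1P3-G17-PROPOSED-1], journal 2026-08-21T22:15Z: «`H, Q₁, Q₂, G` := the compressed periodised level-j tables along `u ↦ V₀^{uh}`
(jets = `perF M (dper M ·)`)»; memo `N2B-DESIGN.md` v5.2 (20d) (ID-1∕2) «`Q₁₁, Q₁₂` = border tables»; R-FP-51 row (T-PER) «+ leaf-02 for `packK`»).  Whatever
compression ∕ reindexing convention the instance adopts, it reads the torus matrices `perF M (dper M (V κ u))` ENTRYWISE; for the border (Q-) slot the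
tables are packer-shaped (`CompositeBorderTables.packK`, an1's `packVH`; the composite `VComp` of R-FP-50 (a) included, `VComp_eq_packK`), and the entries below
are what is read: which slots are DEAD (ff, mm, off-sublattice multipliers — the zero rows ∕ columns the compression drops) and what the LIVE fm entry is.

CONTENT (generic `d`, fibre `F` where possible; blocking `N`, period `M` with `M_i = N·M′_i` — the hypothesis shape `hM : ∀ i, M i = N * M' i`).
* §1 plumbing: `off N (y + M∘m) = off N y`, `blk N (y + M∘m) = blk N y + M′∘m`.
* §2 **`dper_apply_of_blockCov`**: for a family covariant under block translations at blocking `N` (`V κ (u + N•t) = shiftK (−N•t) (V κ u)` — the road's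
  (St)∕(TV) letter shape) `dper M (V κ u) x y a b = Σ'_m V κ (u + M∘m) x y a b` (re-indexing only); `dper_translate_bond` (depends on the bond mod `Mℤ^{d+1}`).
* §3 PACKER-SHAPED tables `packK N T` (no letter on `T`): `dper`∕`perZ ∘ dper` have ff = mm = 0 and fm (resp. mf) entries vanishing unless the multiplier
  site (resp. the first site) lies on the coarse sublattice `off N · = 0` — the DEAD slots.
* §4 the LIVE fm entry (with `T` covariant, `T ρ (w + t) = shiftK (−N•t) (T ρ w)`, `1 ≤ N`): **`perZ_dper_packK_inl_inr`**
  `perZ M (dper M (packK N T κ u)) x z (inl α) (inr ρ) = [off N z = 0] · Σ'_{m′} Σ'_m T ρ (blk N z + M′∘m′) (u + M∘m) x (inl κ) (inl α)` — the double period sum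
  over the copies of the multiplier BLOCK (coarse period `M′`) and of the insertion BOND; primed twin: block FIXED, fluctuation site periodised; mf by §5.
* §5 symmetry: `perZ M (dper M V) x z a b = perZ M (dper M V) z x b a` for an entrywise symmetric `V` (re-indexing only), hence `(perF M (dper M (packK N T κ u)))ᵀ = itself`.
* §7 two-bond (second-order) tables `W κ u κ′ u′` jointly covariant: `dper M (W κ u κ′ u′) = Σ'_m W κ (u+M∘m) κ′ (u′+M∘m)` (simultaneous copies); LOCATED REMARK: the torus SECOND jets pair every copy of one bond with every copy of the other — the insertion of a torus bond pair is the RELATIVE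
  period sum `Σ'_{m′} dper M (W κ u κ′ (u′ + M∘m′))` (`tsum_dper_translate_snd`), `= dper M (W …)` only up to wrap-around terms (row (T-DEPER)).
* §6 finite bond-weighted sums: `dper`∕`perZ`∕`perF` of `Σ_{b ∈ s} c b • K b` are the termwise sums (bi-localised ∕ decaying summands) — background jets.
NOT HERE: the compression∕reindexing to `kkt` block form (leaf-03 `RelInvCompression` ∕ leaf-05 (T-INV-per) ∕ leaf-06 dictionary), the H-∕K-slots, any
identification with Bałaban's objects.  Provenance: D1 formalisation swarm LEAF PROVER 02, unit b2b-balaban-beta-d1-formalise-leaf-02 gen 16, 2026-08-21. -/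

noncomputable section

open scoped BigOperators Matrix

namespace Summit.QuantumFields.BalabanUV.Beta.FP.PeriodisedBorderTables

open Literature.MathematicalPhysics.QuantumFieldTheory.Balaban1983to89
open Literature.MathematicalPhysics.QuantumFieldTheory.Balaban1983to89.Beta
open B4TorusKernel.MultiPeriod (translate translate_apply)
open B4Reflection242 (translate_translate)
open B6Lemma24Torus (pbox)
open ExpKernelCalculus (MKer Decays BiLoc shiftK)
open AffineAveraging (Site)
open AveragingContours (blk off)
open AveragingHessianKernels (off_add_smul blk_add_smul)
open OneStepResolventKernel (Fib)
open Summit.QuantumFields.BalabanUV.Beta.FP.KernelPeriodisationFib (perZ perZ_apply perF perF_apply Idx translate_eq_add decays_abs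
  summable_translate_of_decays)
open Summit.QuantumFields.BalabanUV.Beta.FP.KernelPeriodisationFibLoc (dper dper_apply dper_translate summable_dper)
open Summit.QuantumFields.BalabanUV.Beta.FP.CompositeBorderTables (packK packK_inl_inr packK_inr_inl packK_inl_inl packK_inr_inr packK_symm)
open Summit.QuantumFields.BalabanUV.Beta.FP.CompositeBorderTablesLetters (packK_translate)

variable {d : ℕ} {F : Type*}

/-! ## §1 Period plumbing for a blocking `N` dividing the period `M = N·M′` -/

section Plumbing

variable {N : ℕ} {M M' : Fin (d + 1) → ℕ}

/-- [folklore] a period divisible by the blocking has the shape `M = N·M′` of the hypotheses below (`M′ i := M i / N`; `⟨_, period_eq_mul_div hM⟩`). -/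
theorem period_eq_mul_div (hM : ∀ i, N ∣ M i) (i : Fin (d + 1)) : M i = N * (M i / N) := (Nat.mul_div_cancel' (hM i)).symm

/-- [folklore] the period vector `M∘m` is the `N`-multiple of the coarse period vector `M′∘m`. -/
theorem periodVec_eq_smul (hM : ∀ i, M i = N * M' i) (m : Site (d + 1)) :
    (fun i => (M i : ℤ) * m i) = (N : ℤ) • fun i => (M' i : ℤ) * m i := by
  funext i; simp only [Pi.smul_apply, smul_eq_mul, hM i, Nat.cast_mul]; ring

/-- [folklore] `y + M∘m = y + N•(M′∘m)`. -/
theorem translate_eq_add_smul (hM : ∀ i, M i = N * M' i) (y m : Site (d + 1)) : translate M y m = y + (N : ℤ) • fun i => (M' i : ℤ) * m i := by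
  rw [translate_eq_add, periodVec_eq_smul hM]

/-- [folklore] **the in-block offset is blind to period shifts**: `off N (y + M∘m) = off N y`. -/
theorem off_translate (hM : ∀ i, M i = N * M' i) (y m : Site (d + 1)) : off N (translate M y m) = off N y := by
  rw [translate_eq_add_smul hM, off_add_smul]

/-- [folklore] **the block index moves by the coarse period shift**: `blk N (y + M∘m) = blk N y + M′∘m` (`1 ≤ N`). -/
theorem blk_translate (hN : 1 ≤ N) (hM : ∀ i, M i = N * M' i) (y m : Site (d + 1)) : blk N (translate M y m) = translate M' (blk N y) m := by
  rw [translate_eq_add_smul hM, blk_add_smul hN, translate_eq_add]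

/-- [folklore] `translate M y (−m) + M∘m = y`. -/
theorem translate_neg_add (y m : Site (d + 1)) : translate M y (-m) + (fun i => (M i : ℤ) * m i) = y := by
  funext i; simp only [Pi.add_apply, translate_apply, Pi.neg_apply]; ring

end Plumbing

/-! ## §2 The diagonal periodisation of a block-covariant family: the sum over the translated copies of the bond -/

section BlockCov

variable {N : ℕ} {M M' : Fin (d + 1) → ℕ} {V : Fin (d + 1) → Site (d + 1) → MKer (d + 1) F}

/-- [folklore] one translated copy: for a block-covariant family, `V κ u (x + M∘m) (y + M∘m) = V κ (u − M∘m) x y`. -/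
theorem apply_translate_of_blockCov (hM : ∀ i, M i = N * M' i)
    (hVt : ∀ (κ : Fin (d + 1)) (u t : Site (d + 1)), V κ (u + (N : ℤ) • t) = shiftK (-((N : ℤ) • t)) (V κ u))
    (κ : Fin (d + 1)) (u m x y : Site (d + 1)) (a b : F) :
    V κ u (translate M x m) (translate M y m) a b = V κ (translate M u (-m)) x y a b := by
  have hu : translate M u (-m) + (N : ℤ) • (fun i => (M' i : ℤ) * m i) = u := by
    rw [← periodVec_eq_smul hM]; exact translate_neg_add u m
  have h := hVt κ (translate M u (-m)) (fun i => (M' i : ℤ) * m i)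
  rw [hu] at h
  rw [h]
  simp only [shiftK]
  rw [translate_eq_add_smul hM x m, translate_eq_add_smul hM y m, add_neg_cancel_right, add_neg_cancel_right]

/-- [folklore] **`dper_apply_of_blockCov` — THE TORUS INSERTION IS THE SUM OVER THE COPIES OF THE BOND**: for a family covariant under block translations
at blocking `N` and a period `M = N·M′`, `dper M (V κ u) x y a b = Σ'_m V κ (u + M∘m) x y a b` (re-indexing `m ↦ −m`; no convergence needed). -/
theorem dper_apply_of_blockCov (hM : ∀ i, M i = N * M' i)
    (hVt : ∀ (κ : Fin (d + 1)) (u t : Site (d + 1)), V κ (u + (N : ℤ) • t) = shiftK (-((N : ℤ) • t)) (V κ u))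
    (κ : Fin (d + 1)) (u x y : Site (d + 1)) (a b : F) :
    dper M (V κ u) x y a b = ∑' m : Site (d + 1), V κ (translate M u m) x y a b := by
  rw [dper_apply, ← (Equiv.neg (Site (d + 1))).tsum_eq fun m => V κ (translate M u m) x y a b]
  exact tsum_congr fun m => apply_translate_of_blockCov hM hVt κ u m x y a b

/-- [folklore] **the torus insertion depends on the bond only through the torus bond**: `dper M (V κ (u + M∘m₀)) = dper M (V κ u)`. -/
theorem dper_translate_bond (hM : ∀ i, M i = N * M' i)
    (hVt : ∀ (κ : Fin (d + 1)) (u t : Site (d + 1)), V κ (u + (N : ℤ) • t) = shiftK (-((N : ℤ) • t)) (V κ u))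
    (κ : Fin (d + 1)) (u m₀ : Site (d + 1)) : dper M (V κ (translate M u m₀)) = dper M (V κ u) := by
  funext x y a b
  rw [dper_apply_of_blockCov hM hVt, dper_apply_of_blockCov hM hVt]
  simp only [translate_translate]
  exact (Equiv.addLeft m₀).tsum_eq fun m => V κ (translate M u m) x y a b

end BlockCov

/-! ## §3 Packer-shaped tables: the dead slots (no letter on `T`) -/

section Dead

variable {N : ℕ} {M M' : Fin (d + 1) → ℕ} (T : Fin (d + 1) → Site (d + 1) → MKer (d + 1) (Fib d)) (κ : Fin (d + 1)) (u : Site (d + 1))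

/-- [folklore] `dper` of a packed table has no ff block. -/
@[simp] theorem dper_packK_inl_inl (x y : Site (d + 1)) (α α' : Fin (d + 1)) :
    dper M (packK N T κ u) x y (Sum.inl α) (Sum.inl α') = 0 := by
  simp only [dper_apply, packK_inl_inl, tsum_zero]

/-- [folklore] … and no mm block. -/
@[simp] theorem dper_packK_inr_inr (x y : Site (d + 1)) (ρ ρ' : Fin (d + 1)) :
    dper M (packK N T κ u) x y (Sum.inr ρ) (Sum.inr ρ') = 0 := by
  simp only [dper_apply, packK_inr_inr, tsum_zero]

/-- [folklore] the fm entry of `dper` of a packed table vanishes OFF the coarse sublattice (multiplier site `z` with `off N z ≠ 0`; `N ∣ M`). -/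
theorem dper_packK_inl_inr_of_off_ne_zero (hM : ∀ i, M i = N * M' i) {z : Site (d + 1)} (hz : off N z ≠ 0) (x : Site (d + 1))
    (α ρ : Fin (d + 1)) : dper M (packK N T κ u) x z (Sum.inl α) (Sum.inr ρ) = 0 := by
  rw [dper_apply]
  refine (tsum_congr fun m => ?_).trans tsum_zero
  rw [packK_inl_inr, if_neg]
  rwa [off_translate hM]

/-- [folklore] the mf entry vanishes when the FIRST site is off the coarse sublattice. -/
theorem dper_packK_inr_inl_of_off_ne_zero (hM : ∀ i, M i = N * M' i) {x : Site (d + 1)} (hx : off N x ≠ 0) (z : Site (d + 1))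
    (ρ α : Fin (d + 1)) : dper M (packK N T κ u) x z (Sum.inr ρ) (Sum.inl α) = 0 := by
  rw [dper_apply]
  refine (tsum_congr fun m => ?_).trans tsum_zero
  rw [packK_inr_inl, if_neg]
  rwa [off_translate hM]

/-- [folklore] **the torus border matrix has no ff block** … -/
@[simp] theorem perZ_dper_packK_inl_inl (x y : Site (d + 1)) (α α' : Fin (d + 1)) :
    perZ M (dper M (packK N T κ u)) x y (Sum.inl α) (Sum.inl α') = 0 := by
  simp only [perZ_apply, dper_packK_inl_inl, tsum_zero]

/-- [folklore] … no mm block … -/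
@[simp] theorem perZ_dper_packK_inr_inr (x y : Site (d + 1)) (ρ ρ' : Fin (d + 1)) :
    perZ M (dper M (packK N T κ u)) x y (Sum.inr ρ) (Sum.inr ρ') = 0 := by
  simp only [perZ_apply, dper_packK_inr_inr, tsum_zero]

/-- [folklore] **… and its fm block is supported on the coarse sublattice**: DEAD multiplier columns `(z, inr ρ)`, `off N z ≠ 0`. -/
theorem perZ_dper_packK_inl_inr_of_off_ne_zero (hM : ∀ i, M i = N * M' i) {z : Site (d + 1)} (hz : off N z ≠ 0) (x : Site (d + 1))
    (α ρ : Fin (d + 1)) : perZ M (dper M (packK N T κ u)) x z (Sum.inl α) (Sum.inr ρ) = 0 := by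
  rw [perZ_apply]
  refine (tsum_congr fun m => ?_).trans tsum_zero
  exact dper_packK_inl_inr_of_off_ne_zero T κ u hM (by rwa [off_translate hM]) x α ρ

/-- [folklore] … DEAD multiplier rows `(x, inr ρ)`, `off N x ≠ 0`. -/
theorem perZ_dper_packK_inr_inl_of_off_ne_zero (hM : ∀ i, M i = N * M' i) {x : Site (d + 1)} (hx : off N x ≠ 0) (z : Site (d + 1))
    (ρ α : Fin (d + 1)) : perZ M (dper M (packK N T κ u)) x z (Sum.inr ρ) (Sum.inl α) = 0 := by
  rw [perZ_apply]
  refine (tsum_congr fun m => ?_).trans tsum_zero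
  exact dper_packK_inr_inl_of_off_ne_zero T κ u hM hx _ ρ α

end Dead

/-! ## §4 Packer-shaped tables: the live fm entry (covariant `T`) -/

section Live

variable {N : ℕ} {M M' : Fin (d + 1) → ℕ} {T : Fin (d + 1) → Site (d + 1) → MKer (d + 1) (Fib d)}

/-- [folklore] the fm entry of `dper` of a packed table: on the coarse sublattice it is the period sum over the copies of the insertion bond of the unpacked
tensor at the FIXED block `blk N z`. -/
theorem dper_packK_inl_inr (hN : 1 ≤ N) (hM : ∀ i, M i = N * M' i)
    (hT : ∀ (ρ : Fin (d + 1)) (w t : Site (d + 1)), T ρ (w + t) = shiftK (-((N : ℤ) • t)) (T ρ w))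
    (κ : Fin (d + 1)) (u x z : Site (d + 1)) (α ρ : Fin (d + 1)) :
    dper M (packK N T κ u) x z (Sum.inl α) (Sum.inr ρ) =
      if off N z = 0 then ∑' m : Site (d + 1), T ρ (blk N z) (translate M u m) x (Sum.inl κ) (Sum.inl α) else 0 := by
  rw [dper_apply_of_blockCov hM (packK_translate hN hT) κ u x z]
  by_cases hz : off N z = 0
  · rw [if_pos hz]
    exact tsum_congr fun m => by rw [packK_inl_inr, if_pos hz]
  · rw [if_neg hz]
    exact (tsum_congr fun m => by rw [packK_inl_inr, if_neg hz]).trans tsum_zero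

/-- [folklore] **`perZ_dper_packK_inl_inr` — THE LIVE BORDER ENTRY ON THE TORUS**: `perZ M (dper M (packK N T κ u)) x z (inl α) (inr ρ) =
[off N z = 0] · Σ'_{m′} Σ'_m T ρ (blk N z + M′∘m′) (u + M∘m) x (inl κ) (inl α)` — the double period sum over the copies of the multiplier BLOCK (coarse
period `M′`) and of the insertion BOND. -/
theorem perZ_dper_packK_inl_inr (hN : 1 ≤ N) (hM : ∀ i, M i = N * M' i)
    (hT : ∀ (ρ : Fin (d + 1)) (w t : Site (d + 1)), T ρ (w + t) = shiftK (-((N : ℤ) • t)) (T ρ w))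
    (κ : Fin (d + 1)) (u x z : Site (d + 1)) (α ρ : Fin (d + 1)) :
    perZ M (dper M (packK N T κ u)) x z (Sum.inl α) (Sum.inr ρ) =
      if off N z = 0 then
        ∑' m' : Site (d + 1), ∑' m : Site (d + 1), T ρ (translate M' (blk N z) m') (translate M u m) x (Sum.inl κ) (Sum.inl α)
      else 0 := by
  rw [perZ_apply]
  simp only [dper_packK_inl_inr hN hM hT, off_translate hM, blk_translate hN hM]
  by_cases hz : off N z = 0
  · simp only [hz, if_true]
  · simp only [hz, if_false, tsum_zero]

/-- [folklore] the same entry with the multiplier BLOCK FIXED and the fluctuation site periodised instead (one more use of the covariance of `T`: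
`T ρ (w + M′∘m′) u′ x = T ρ w (u′ − M∘m′) (x − M∘m′)`, then `m ↦ m + m′`, `m′ ↦ −m′`):
`… = [off N z = 0] · Σ'_{m′} Σ'_m T ρ (blk N z) (u + M∘m) (x + M∘m′) (inl κ) (inl α)`. -/
theorem perZ_dper_packK_inl_inr' (hN : 1 ≤ N) (hM : ∀ i, M i = N * M' i)
    (hT : ∀ (ρ : Fin (d + 1)) (w t : Site (d + 1)), T ρ (w + t) = shiftK (-((N : ℤ) • t)) (T ρ w))
    (κ : Fin (d + 1)) (u x z : Site (d + 1)) (α ρ : Fin (d + 1)) :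
    perZ M (dper M (packK N T κ u)) x z (Sum.inl α) (Sum.inr ρ) =
      if off N z = 0 then
        ∑' m' : Site (d + 1), ∑' m : Site (d + 1), T ρ (blk N z) (translate M u m) (translate M x m') (Sum.inl κ) (Sum.inl α)
      else 0 := by
  rw [perZ_dper_packK_inl_inr hN hM hT]
  by_cases hz : off N z = 0
  · rw [if_pos hz, if_pos hz, ← (Equiv.neg (Site (d + 1))).tsum_eq fun m' =>
      ∑' m : Site (d + 1), T ρ (blk N z) (translate M u m) (translate M x m') (Sum.inl κ) (Sum.inl α)]
    refine tsum_congr fun m' => ?_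
    rw [← (Equiv.addRight (-m')).tsum_eq fun m => T ρ (blk N z) (translate M u m) (translate M x (Equiv.neg _ m')) (Sum.inl κ) (Sum.inl α)]
    refine tsum_congr fun m => ?_
    have h := hT ρ (blk N z) (fun i => (M' i : ℤ) * m' i)
    rw [← translate_eq_add] at h
    rw [h]
    simp only [shiftK, Equiv.neg_apply, Equiv.coe_addRight, ← periodVec_eq_smul hM]
    congr 1
    · funext i; simp only [Pi.add_apply, Pi.neg_apply, B4TorusKernel.MultiPeriod.translate_apply]; ring
    · funext i; simp only [Pi.add_apply, Pi.neg_apply, B4TorusKernel.MultiPeriod.translate_apply]; ring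
  · rw [if_neg hz, if_neg hz]

end Live

/-! ## §5 Symmetry -/

section Symm

variable (M : Fin (d + 1) → ℕ)

/-- [folklore] **`perZ ∘ dper` of an entrywise SYMMETRIC insertion is symmetric** (re-indexing only: inner `m ↦ m − m′`, outer `m′ ↦ −m′`). -/
theorem perZ_dper_symm {V : MKer (d + 1) F} (hV : ∀ (x z : Site (d + 1)) (a b : F), V x z a b = V z x b a)
    (x z : Site (d + 1)) (a b : F) : perZ M (dper M V) x z a b = perZ M (dper M V) z x b a := by
  simp only [perZ_apply, dper_apply, translate_translate]
  rw [← (Equiv.neg (Site (d + 1))).tsum_eq fun m' => ∑' m, V (translate M z m) (translate M x (m' + m)) b a]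
  refine tsum_congr fun m' => ?_
  rw [← (Equiv.addRight (-m')).tsum_eq fun m => V (translate M x m) (translate M z (m' + m)) a b]
  refine tsum_congr fun m => ?_
  simp only [Equiv.neg_apply, Equiv.coe_addRight, hV (translate M x _)]
  congr 2 <;> abel_nf

/-- [folklore] hence the torus matrix of a symmetric insertion is a symmetric matrix … -/
theorem perF_dper_transpose {V : MKer (d + 1) F} (hV : ∀ (x z : Site (d + 1)) (a b : F), V x z a b = V z x b a) :
    (perF M (dper M V))ᵀ = perF M (dper M V) := by
  ext p q
  rw [Matrix.transpose_apply, perF_apply, perF_apply]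
  exact perZ_dper_symm M hV _ _ _ _

/-- [folklore] … in particular for every packed border table (`packK_symm`). -/
theorem perF_dper_packK_transpose {N : ℕ} (T : Fin (d + 1) → Site (d + 1) → MKer (d + 1) (Fib d)) (κ : Fin (d + 1)) (u : Site (d + 1)) :
    (perF M (dper M (packK N T κ u)))ᵀ = perF M (dper M (packK N T κ u)) := perF_dper_transpose M (packK_symm N T κ u)

/-- [folklore] the mf entry of the torus border matrix is the fm entry read backwards. -/
theorem perZ_dper_packK_inr_inl {N : ℕ} (T : Fin (d + 1) → Site (d + 1) → MKer (d + 1) (Fib d)) (κ : Fin (d + 1)) (u x z : Site (d + 1))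
    (ρ α : Fin (d + 1)) :
    perZ M (dper M (packK N T κ u)) x z (Sum.inr ρ) (Sum.inl α) = perZ M (dper M (packK N T κ u)) z x (Sum.inl α) (Sum.inr ρ) :=
  perZ_dper_symm M (packK_symm N T κ u) _ _ _ _

end Symm

/-! ## §6 Finite bond-weighted sums periodise termwise -/

section Sums

variable (M : Fin (d + 1) → ℕ) {ι : Type*}

/-- [folklore] `dper M (c • V) = c • dper M V` (no convergence needed). -/
theorem dper_smul (c : ℝ) (V : MKer (d + 1) F) : dper M (c • V) = c • dper M V := by
  funext x y a b; simp only [dper_apply, Pi.smul_apply, smul_eq_mul]; exact tsum_mul_left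

variable [∀ μ, NeZero (M μ)]

/-- [folklore] **`dper` of a finite sum of BI-LOCALISED insertions is the sum of the `dper`s** (each summand's period sum converges, `summable_dper`). -/
theorem dper_finset_sum (s : Finset ι) (V : ι → MKer (d + 1) F)
    (hV : ∀ i ∈ s, ∃ (p q : Site (d + 1)) (C δ : ℝ), 0 ≤ C ∧ 0 < δ ∧ BiLoc (V i) p q C δ) :
    dper M (∑ i ∈ s, V i) = ∑ i ∈ s, dper M (V i) := by
  funext x y a b
  simp only [dper_apply, Finset.sum_apply]
  refine Summable.tsum_finsetSum fun i hi => ?_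
  obtain ⟨p, q, C, δ, hC, hδ, hVi⟩ := hV i hi
  exact summable_dper M hVi hC hδ x y a b

/-- [folklore] **the background jet along a finitely supported bond weight periodises termwise**: `dper M (Σ_{b ∈ s} h b • V b) = Σ_{b ∈ s} h b • dper M (V b)`. -/
theorem dper_finset_sum_smul (s : Finset ι) (h : ι → ℝ) (V : ι → MKer (d + 1) F)
    (hV : ∀ i ∈ s, ∃ (p q : Site (d + 1)) (C δ : ℝ), 0 ≤ C ∧ 0 < δ ∧ BiLoc (V i) p q C δ) :
    dper M (∑ i ∈ s, h i • V i) = ∑ i ∈ s, h i • dper M (V i) := by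
  rw [dper_finset_sum M s (fun i => h i • V i) fun i hi => ?_]
  · exact Finset.sum_congr rfl fun i _ => dper_smul M (h i) (V i)
  · obtain ⟨p, q, C, δ, hC, hδ, hVi⟩ := hV i hi
    refine ⟨p, q, |h i| * C, δ, by positivity, hδ, fun x y a b => ?_⟩
    rw [Pi.smul_apply, Pi.smul_apply, Pi.smul_apply, Pi.smul_apply, smul_eq_mul, abs_mul, mul_assoc]
    exact mul_le_mul_of_nonneg_left (hVi x y a b) (abs_nonneg _)

/-- [folklore] **`perZ` of a finite sum of DECAYING kernels is the sum of the `perZ`s.** -/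
theorem perZ_finset_sum (s : Finset ι) (K : ι → MKer (d + 1) F) (hK : ∀ i ∈ s, ∃ C δ : ℝ, 0 < δ ∧ Decays (K i) C δ) :
    perZ M (∑ i ∈ s, K i) = ∑ i ∈ s, perZ M (K i) := by
  have hM1 : ∀ i, 1 ≤ M i := fun i => Nat.one_le_iff_ne_zero.2 (NeZero.ne _)
  funext x y a b
  simp only [perZ_apply, Finset.sum_apply]
  refine Summable.tsum_finsetSum fun i hi => ?_
  obtain ⟨C, δ, hδ, hKi⟩ := hK i hi
  exact summable_translate_of_decays (decays_abs hKi) (abs_nonneg _) hδ hM1 x y a b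

/-- [folklore] the matrix form: `perF M (Σ_{i ∈ s} K i) = Σ_{i ∈ s} perF M (K i)` for decaying summands. -/
theorem perF_finset_sum (s : Finset ι) (K : ι → MKer (d + 1) F) (hK : ∀ i ∈ s, ∃ C δ : ℝ, 0 < δ ∧ Decays (K i) C δ) :
    perF M (∑ i ∈ s, K i) = ∑ i ∈ s, perF M (K i) := by
  ext p q
  simp only [perF_apply, perZ_finset_sum M s K hK, Finset.sum_apply, Matrix.sum_apply]

end Sums

/-! ## §7 Two-bond (second-order) tables: simultaneous copies, and the relative period sum -/

section TwoBond

variable {N : ℕ} {M M' : Fin (d + 1) → ℕ} {W : Fin (d + 1) → Site (d + 1) → Fin (d + 1) → Site (d + 1) → MKer (d + 1) F}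

/-- [folklore] one SIMULTANEOUS translated copy of the bond pair of a jointly block-covariant two-bond family. -/
theorem apply_translate_of_blockCov₂ (hM : ∀ i, M i = N * M' i)
    (hWt : ∀ (κ : Fin (d + 1)) (u : Site (d + 1)) (κ' : Fin (d + 1)) (u' t : Site (d + 1)),
      W κ (u + (N : ℤ) • t) κ' (u' + (N : ℤ) • t) = shiftK (-((N : ℤ) • t)) (W κ u κ' u'))
    (κ : Fin (d + 1)) (u : Site (d + 1)) (κ' : Fin (d + 1)) (u' m x y : Site (d + 1)) (a b : F) :
    W κ u κ' u' (translate M x m) (translate M y m) a b = W κ (translate M u (-m)) κ' (translate M u' (-m)) x y a b := by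
  have hu : translate M u (-m) + (N : ℤ) • (fun i => (M' i : ℤ) * m i) = u := by
    rw [← periodVec_eq_smul hM]; exact translate_neg_add u m
  have hu' : translate M u' (-m) + (N : ℤ) • (fun i => (M' i : ℤ) * m i) = u' := by
    rw [← periodVec_eq_smul hM]; exact translate_neg_add u' m
  have h := hWt κ (translate M u (-m)) κ' (translate M u' (-m)) (fun i => (M' i : ℤ) * m i)
  rw [hu, hu'] at h
  rw [h]
  simp only [shiftK]
  rw [translate_eq_add_smul hM x m, translate_eq_add_smul hM y m, add_neg_cancel_right, add_neg_cancel_right]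

/-- [folklore] **`dper` of a two-bond table is the sum over the SIMULTANEOUS copies of the bond pair**:
`dper M (W κ u κ′ u′) x y a b = Σ'_m W κ (u + M∘m) κ′ (u′ + M∘m) x y a b` (re-indexing only).  LOCATED REMARK (for the torus instance's SECOND jets):
the second background derivative of a periodised kernel along an `M`-periodic test field pairs EVERY copy of one bond with EVERY copy of the other, i.e. the
torus insertion of the torus bond pair is the further period sum `Σ'_{m′} dper M (W κ u κ′ (u′ + M∘m′))` in the RELATIVE bond position — equal to `dper M (W κ u κ′ u′)`
only up to the wrap-around terms `m′ ≠ 0` (exponentially small in `min M_i` for a family localised in the bond separation; exact de-periodisation is row (T-DEPER)). -/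
theorem dper_apply_of_blockCov₂ (hM : ∀ i, M i = N * M' i)
    (hWt : ∀ (κ : Fin (d + 1)) (u : Site (d + 1)) (κ' : Fin (d + 1)) (u' t : Site (d + 1)),
      W κ (u + (N : ℤ) • t) κ' (u' + (N : ℤ) • t) = shiftK (-((N : ℤ) • t)) (W κ u κ' u'))
    (κ : Fin (d + 1)) (u : Site (d + 1)) (κ' : Fin (d + 1)) (u' x y : Site (d + 1)) (a b : F) :
    dper M (W κ u κ' u') x y a b = ∑' m : Site (d + 1), W κ (translate M u m) κ' (translate M u' m) x y a b := by
  rw [dper_apply, ← (Equiv.neg (Site (d + 1))).tsum_eq fun m => W κ (translate M u m) κ' (translate M u' m) x y a b]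
  exact tsum_congr fun m => apply_translate_of_blockCov₂ hM hWt κ u κ' u' m x y a b

/-- [folklore] the relative period sum written over all pairs of copies: `Σ'_{m′} dper M (W κ u κ′ (u′ + M∘m′)) … = Σ'_{m′} Σ'_m W κ (u + M∘m) κ′ (u′ + M∘(m′ + m)) …`. -/
theorem tsum_dper_translate_snd (hM : ∀ i, M i = N * M' i)
    (hWt : ∀ (κ : Fin (d + 1)) (u : Site (d + 1)) (κ' : Fin (d + 1)) (u' t : Site (d + 1)),
      W κ (u + (N : ℤ) • t) κ' (u' + (N : ℤ) • t) = shiftK (-((N : ℤ) • t)) (W κ u κ' u'))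
    (κ : Fin (d + 1)) (u : Site (d + 1)) (κ' : Fin (d + 1)) (u' x y : Site (d + 1)) (a b : F) :
    ∑' m' : Site (d + 1), dper M (W κ u κ' (translate M u' m')) x y a b =
      ∑' m' : Site (d + 1), ∑' m : Site (d + 1), W κ (translate M u m) κ' (translate M u' (m' + m)) x y a b := by
  refine tsum_congr fun m' => ?_
  rw [dper_apply_of_blockCov₂ hM hWt]
  simp only [translate_translate]

end TwoBond

end Summit.QuantumFields.BalabanUV.Beta.FP.PeriodisedBorderTables

end
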